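import Literature.RingTheory.FormalGroups.NilpotentEvaluationPair
import Mathlib.RingTheory.Ideal.Quotient.Operations
import HarnessLib

/-!
# Power series are determined by their values on nilpotent points (separation lemmas)
# ([Bourbaki, Algebra II] Ch. IV §4 no. 3; P6d points currency, desk word (β) item (ii))

Topic `Literature/RingTheory/FormalGroups`; namespace `Literature.RingTheory.FormalGroups`.  THEOREMS ONLY (no definition, no named fact,
no instance, no notation, no `sorry`).  Cell `hodgecm-mathlib`, P6 «MOD programme» ROW 4B — desk F0P6d-plan (g0) (β) (ii): «a SEPARATION
lemma "series are determined by nilpotent points" … and the `Fin 2` twin … that is how the law `F` and `ρ a` get DEFINED from `B`'s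
`μ`∕`β` coefficientwise».  Test points: `x̄ = X mod X^N` in `A⟦X⟧⧸(X^N)`, resp. `(X̄₀, X̄₁)` in `A⟦X₀,X₁⟧⧸(X₀^N, X₁^N)`.

## Contents

* `evalNilp_mk_X` — `evalNilp f x̄ = Σ_{i<N} fᵢ X^i mod (X^N)`; `coeff_eq_of_evalNilp_mk_X_eq` — equal values at `x̄ ∈ A⟦X⟧⧸(X^N)` ⇒ equal
  coefficients below `N`; **`eq_of_forall_evalNilp_mk_X_eq`** and **`eq_of_forall_evalNilp_eq`** (all `A`-algebras, all nilpotent points).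
* the two-variable twins `evalNilp₂_mk_X`, `coeff_eq_of_evalNilp₂_mk_X_eq`, **`eq_of_forall_evalNilp₂_mk_X_eq`**, **`eq_of_forall_evalNilp₂_eq`**.
-/

noncomputable section

namespace Literature.RingTheory.FormalGroups

open Finset

universe u

variable {A : Type u} [CommRing A]

/-! ## §1 One variable: test algebra `A⟦X⟧ ⧸ (X^N)` -/

/-- The universal nilpotent point `x̄ = X mod X^N` is nilpotent: `x̄^N = 0`. [cite: BourbakiAlgebraII2003, Ch. IV §4 no. 3] -/
theorem mk_X_pow_eq_zero (N : ℕ) :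
    (Ideal.Quotient.mk (Ideal.span {(PowerSeries.X : PowerSeries A) ^ N}) PowerSeries.X) ^ N = 0 := by
  rw [← map_pow, Ideal.Quotient.eq_zero_iff_mem]
  exact Ideal.subset_span rfl

/-- **`evalNilp f x̄ = (Σ_{i<N} fᵢ X^i) mod X^N`** at the universal point `x̄ ∈ A⟦X⟧⧸(X^N)`. [cite: BourbakiAlgebraII2003, Ch. IV §4 no. 3] -/
theorem evalNilp_mk_X (f : PowerSeries A) (N : ℕ) :
    evalNilp f (Ideal.Quotient.mk (Ideal.span {(PowerSeries.X : PowerSeries A) ^ N}) PowerSeries.X) =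
      Ideal.Quotient.mk (Ideal.span {(PowerSeries.X : PowerSeries A) ^ N})
        (∑ i ∈ range N, PowerSeries.coeff i f • (PowerSeries.X : PowerSeries A) ^ i) := by
  rw [evalNilp_eq_sum f (mk_X_pow_eq_zero N), map_sum]
  refine Finset.sum_congr rfl fun i _ => ?_
  rw [Algebra.smul_def, map_mul, map_pow, Ideal.Quotient.mk_algebraMap]

/-- Coefficients of the truncated expansion `Σ_{i<N} fᵢ X^i`. [cite: BourbakiAlgebraII2003, Ch. IV §4 no. 1] -/
theorem coeff_sum_smul_X_pow (f : PowerSeries A) (N : ℕ) {m : ℕ} (hm : m < N) :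
    PowerSeries.coeff m (∑ i ∈ range N, PowerSeries.coeff i f • (PowerSeries.X : PowerSeries A) ^ i) = PowerSeries.coeff m f := by
  rw [map_sum, Finset.sum_eq_single m]
  · rw [map_smul, PowerSeries.coeff_X_pow, if_pos rfl, smul_eq_mul, mul_one]
  · intro i _ him
    rw [map_smul, PowerSeries.coeff_X_pow, if_neg (Ne.symm him), smul_zero]
  · intro h; exact absurd (Finset.mem_range.mpr hm) h

/-- **Equal values at `x̄ ∈ A⟦X⟧⧸(X^N)` ⇒ equal coefficients below `N`.** [cite: BourbakiAlgebraII2003, Ch. IV §4 no. 3] -/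
theorem coeff_eq_of_evalNilp_mk_X_eq {f g : PowerSeries A} {N : ℕ}
    (h : evalNilp f (Ideal.Quotient.mk (Ideal.span {(PowerSeries.X : PowerSeries A) ^ N}) PowerSeries.X) =
      evalNilp g (Ideal.Quotient.mk (Ideal.span {(PowerSeries.X : PowerSeries A) ^ N}) PowerSeries.X)) {m : ℕ} (hm : m < N) :
    PowerSeries.coeff m f = PowerSeries.coeff m g := by
  rw [evalNilp_mk_X, evalNilp_mk_X, Ideal.Quotient.eq, Ideal.mem_span_singleton] at h
  have hc := (PowerSeries.X_pow_dvd_iff.mp h) m hm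
  rw [map_sub, coeff_sum_smul_X_pow f N hm, coeff_sum_smul_X_pow g N hm, sub_eq_zero] at hc
  exact hc

/-- **SEPARATION (one variable, universal test points)**: a power series is determined by its values at the points `x̄ ∈ A⟦X⟧⧸(X^N)`, `N ≥ 0`.
[cite: BourbakiAlgebraII2003, Ch. IV §4 no. 3] -/
theorem eq_of_forall_evalNilp_mk_X_eq {f g : PowerSeries A}
    (h : ∀ N : ℕ, evalNilp f (Ideal.Quotient.mk (Ideal.span {(PowerSeries.X : PowerSeries A) ^ N}) PowerSeries.X) =
      evalNilp g (Ideal.Quotient.mk (Ideal.span {(PowerSeries.X : PowerSeries A) ^ N}) PowerSeries.X)) : f = g := by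
  ext m
  exact coeff_eq_of_evalNilp_mk_X_eq (h (m + 1)) (Nat.lt_succ_self m)

/-- **SEPARATION (one variable, all nilpotent points)**: if `f(x) = g(x)` for every nilpotent `x` of every `A`-algebra, then `f = g`.
[cite: BourbakiAlgebraII2003, Ch. IV §4 no. 3] -/
theorem eq_of_forall_evalNilp_eq {f g : PowerSeries A}
    (h : ∀ (R : Type u) [CommRing R] [Algebra A R] (x : R), IsNilpotent x → evalNilp f x = evalNilp g x) : f = g :=
  eq_of_forall_evalNilp_mk_X_eq fun N => h _ _ ⟨N, mk_X_pow_eq_zero N⟩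

/-! ## §2 Two variables: test algebra `A⟦X₀,X₁⟧ ⧸ (X₀^N, X₁^N)` -/

/-- The universal nilpotent coordinates are nilpotent: `X̄ᵢ^N = 0` in `A⟦X₀,X₁⟧⧸(X₀^N, X₁^N)`. [cite: BourbakiAlgebraII2003, Ch. IV §4 no. 3] -/
theorem mk_X_pow_eq_zero₂ (N : ℕ) (i : Fin 2) :
    (Ideal.Quotient.mk (Ideal.span {(MvPowerSeries.X 0 : MvPowerSeries (Fin 2) A) ^ N, (MvPowerSeries.X 1) ^ N})
      (MvPowerSeries.X i)) ^ N = 0 := by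
  rw [← map_pow, Ideal.Quotient.eq_zero_iff_mem]
  refine Ideal.subset_span ?_
  fin_cases i
  · exact Set.mem_insert _ _
  · exact Set.mem_insert_of_mem _ (Set.mem_singleton _)

/-- **`evalNilp₂ F X̄₀ X̄₁ = (Σ_{i,j<N} F_{ij} X₀^i X₁^j) mod (X₀^N, X₁^N)`.** [cite: BourbakiAlgebraII2003, Ch. IV §4 no. 3] -/
theorem evalNilp₂_mk_X (F : MvPowerSeries (Fin 2) A) (N : ℕ) :
    evalNilp₂ F
      (Ideal.Quotient.mk (Ideal.span {(MvPowerSeries.X 0 : MvPowerSeries (Fin 2) A) ^ N, (MvPowerSeries.X 1) ^ N}) (MvPowerSeries.X 0))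
      (Ideal.Quotient.mk (Ideal.span {(MvPowerSeries.X 0 : MvPowerSeries (Fin 2) A) ^ N, (MvPowerSeries.X 1) ^ N}) (MvPowerSeries.X 1)) =
      Ideal.Quotient.mk (Ideal.span {(MvPowerSeries.X 0 : MvPowerSeries (Fin 2) A) ^ N, (MvPowerSeries.X 1) ^ N})
        (∑ i ∈ range N, ∑ j ∈ range N, MvPowerSeries.coeff (Finsupp.single 0 i + Finsupp.single 1 j) F •
          ((MvPowerSeries.X 0 : MvPowerSeries (Fin 2) A) ^ i * (MvPowerSeries.X 1) ^ j)) := by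
  rw [evalNilp₂_eq_sum F (mk_X_pow_eq_zero₂ N 0) (mk_X_pow_eq_zero₂ N 1), map_sum]
  refine Finset.sum_congr rfl fun i _ => ?_
  rw [map_sum]
  refine Finset.sum_congr rfl fun j _ => ?_
  rw [Algebra.smul_def, map_mul, map_mul, map_pow, map_pow, Ideal.Quotient.mk_algebraMap, mul_assoc]

/-- Coefficients of the truncated double expansion. [cite: BourbakiAlgebraII2003, Ch. IV §4 no. 1] -/
theorem coeff_sum_sum_smul_X_pow (F : MvPowerSeries (Fin 2) A) (N : ℕ) {d : Fin 2 →₀ ℕ} (h0 : d 0 < N) (h1 : d 1 < N) :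
    MvPowerSeries.coeff d (∑ i ∈ range N, ∑ j ∈ range N, MvPowerSeries.coeff (Finsupp.single 0 i + Finsupp.single 1 j) F •
      ((MvPowerSeries.X 0 : MvPowerSeries (Fin 2) A) ^ i * (MvPowerSeries.X 1) ^ j)) = MvPowerSeries.coeff d F := by
  classical
  have hmono : ∀ i j : ℕ, ((MvPowerSeries.X 0 : MvPowerSeries (Fin 2) A) ^ i * (MvPowerSeries.X 1) ^ j) =
      MvPowerSeries.monomial (Finsupp.single 0 i + Finsupp.single 1 j) 1 := by
    intro i j
    rw [MvPowerSeries.X_pow_eq, MvPowerSeries.X_pow_eq, MvPowerSeries.monomial_mul_monomial, one_mul]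
  simp_rw [hmono, map_sum, map_smul, MvPowerSeries.coeff_monomial, smul_eq_mul, mul_ite, mul_one, mul_zero]
  rw [Finset.sum_eq_single (d 0)]
  · rw [Finset.sum_eq_single (d 1)]
    · rw [if_pos (single_add_single_eq d).symm, single_add_single_eq]
    · intro j _ hj
      rw [if_neg]
      intro h; apply hj
      have := congrArg (fun e : Fin 2 →₀ ℕ => e 1) h
      simpa using this.symm
    · intro h; exact absurd (Finset.mem_range.mpr h1) h
  · intro i _ hi
    refine Finset.sum_eq_zero fun j _ => ?_
    rw [if_neg]
    intro h; apply hi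
    have := congrArg (fun e : Fin 2 →₀ ℕ => e 0) h
    simpa using this.symm
  · intro h; exact absurd (Finset.mem_range.mpr h0) h

/-- Membership in `(X₀^N, X₁^N)` kills the coefficients in the box `d₀, d₁ < N`. [cite: BourbakiAlgebraII2003, Ch. IV §4 no. 1] -/
theorem coeff_eq_zero_of_mem_span_X_pow {H : MvPowerSeries (Fin 2) A} {N : ℕ}
    (hH : H ∈ Ideal.span {(MvPowerSeries.X 0 : MvPowerSeries (Fin 2) A) ^ N, (MvPowerSeries.X 1) ^ N}) {d : Fin 2 →₀ ℕ}
    (h0 : d 0 < N) (h1 : d 1 < N) : MvPowerSeries.coeff d H = 0 := by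
  obtain ⟨p, q, rfl⟩ := Ideal.mem_span_pair.mp hH
  rw [map_add, MvPowerSeries.X_pow_eq, MvPowerSeries.X_pow_eq, MvPowerSeries.coeff_mul_monomial, MvPowerSeries.coeff_mul_monomial,
    if_neg (fun h => absurd (Finsupp.single_le_iff.mp h) (not_le.mpr h0)),
    if_neg (fun h => absurd (Finsupp.single_le_iff.mp h) (not_le.mpr h1)), add_zero]

/-- **Equal values at `(X̄₀, X̄₁) ∈ A⟦X₀,X₁⟧⧸(X₀^N, X₁^N)` ⇒ equal coefficients in the box `d₀, d₁ < N`.** [cite: BourbakiAlgebraII2003, Ch. IV §4 no. 3] -/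
theorem coeff_eq_of_evalNilp₂_mk_X_eq {F G : MvPowerSeries (Fin 2) A} {N : ℕ}
    (h : evalNilp₂ F
        (Ideal.Quotient.mk (Ideal.span {(MvPowerSeries.X 0 : MvPowerSeries (Fin 2) A) ^ N, (MvPowerSeries.X 1) ^ N}) (MvPowerSeries.X 0))
        (Ideal.Quotient.mk (Ideal.span {(MvPowerSeries.X 0 : MvPowerSeries (Fin 2) A) ^ N, (MvPowerSeries.X 1) ^ N}) (MvPowerSeries.X 1)) =
      evalNilp₂ G
        (Ideal.Quotient.mk (Ideal.span {(MvPowerSeries.X 0 : MvPowerSeries (Fin 2) A) ^ N, (MvPowerSeries.X 1) ^ N}) (MvPowerSeries.X 0))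
        (Ideal.Quotient.mk (Ideal.span {(MvPowerSeries.X 0 : MvPowerSeries (Fin 2) A) ^ N, (MvPowerSeries.X 1) ^ N}) (MvPowerSeries.X 1)))
    {d : Fin 2 →₀ ℕ} (h0 : d 0 < N) (h1 : d 1 < N) : MvPowerSeries.coeff d F = MvPowerSeries.coeff d G := by
  rw [evalNilp₂_mk_X, evalNilp₂_mk_X, Ideal.Quotient.eq] at h
  have hc := coeff_eq_zero_of_mem_span_X_pow h h0 h1
  rw [map_sub, coeff_sum_sum_smul_X_pow F N h0 h1, coeff_sum_sum_smul_X_pow G N h0 h1, sub_eq_zero] at hc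
  exact hc

/-- **SEPARATION (two variables, universal test points)**: a two-variable series is determined by its values at the points
`(X̄₀, X̄₁) ∈ A⟦X₀,X₁⟧⧸(X₀^N, X₁^N)`, `N ≥ 0`. [cite: BourbakiAlgebraII2003, Ch. IV §4 no. 3] -/
theorem eq_of_forall_evalNilp₂_mk_X_eq {F G : MvPowerSeries (Fin 2) A}
    (h : ∀ N : ℕ, evalNilp₂ F
        (Ideal.Quotient.mk (Ideal.span {(MvPowerSeries.X 0 : MvPowerSeries (Fin 2) A) ^ N, (MvPowerSeries.X 1) ^ N}) (MvPowerSeries.X 0))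
        (Ideal.Quotient.mk (Ideal.span {(MvPowerSeries.X 0 : MvPowerSeries (Fin 2) A) ^ N, (MvPowerSeries.X 1) ^ N}) (MvPowerSeries.X 1)) =
      evalNilp₂ G
        (Ideal.Quotient.mk (Ideal.span {(MvPowerSeries.X 0 : MvPowerSeries (Fin 2) A) ^ N, (MvPowerSeries.X 1) ^ N}) (MvPowerSeries.X 0))
        (Ideal.Quotient.mk (Ideal.span {(MvPowerSeries.X 0 : MvPowerSeries (Fin 2) A) ^ N, (MvPowerSeries.X 1) ^ N}) (MvPowerSeries.X 1))) :
    F = G := by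
  ext d
  exact coeff_eq_of_evalNilp₂_mk_X_eq (h (d 0 + d 1 + 1)) (by omega) (by omega)

/-- **SEPARATION (two variables, all nilpotent points)**: if `F(x,y) = G(x,y)` for every nilpotent pair of every `A`-algebra, then `F = G`.
[cite: BourbakiAlgebraII2003, Ch. IV §4 no. 3] -/
theorem eq_of_forall_evalNilp₂_eq {F G : MvPowerSeries (Fin 2) A}
    (h : ∀ (R : Type u) [CommRing R] [Algebra A R] (x y : R), IsNilpotent x → IsNilpotent y → evalNilp₂ F x y = evalNilp₂ G x y) :
    F = G :=
  eq_of_forall_evalNilp₂_mk_X_eq fun N => h _ _ _ ⟨N, mk_X_pow_eq_zero₂ N 0⟩ ⟨N, mk_X_pow_eq_zero₂ N 1⟩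

end Literature.RingTheory.FormalGroups
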